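import Literature.MathematicalPhysics.QuantumFieldTheory.BalabanRegulatorChart
import Summits.QuantumFields.YangMills.Theses.ParabolicTrajectory
import Summits.QuantumFields.YangMills.Theorems.BalabanStepParabolic.Negative.CurvatureOnly
import Summits.QuantumFields.YangMills.Theorems.BalabanStepParabolic.Negative.OrbitTransport

/-!
# Crux `BalabanStepParabolic` ⇐ `RegulatorChartExists` — refuter drefute certificate (both periphery stubs proved)

Concatenation of `ParabolicBlock.lean` (stub 2) and `Realisation.lean` (stub 3) of refuter-drefute-stmt-QuantumFields-9684-0,
followed by the composition. Sorry-free.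
-/

/-!
# `stub_parabolicBlock` of line `perfect-action-regulator-chart` (crux `BalabanStepParabolic`) — candidate proof

Refuter drefute certificate (refuter-drefute-stmt-QuantumFields-9684-0): the registered stub statement
`ParabolicBlockOfSmooth` (skeleton v3, stated in full) is TRUE as typed. Witness: the odd/even extension
`φ' g y = if 0 ≤ g then φ g y else -φ (-g) y`, `Ψ' g y = Ψ |g| y`, constant `C' = 2C + 1`; every clause is a
one-variable mean value inequality (`norm_image_sub_le_of_norm_deriv_le_segment'` on sub-intervals of `[0, δ]`,
`Convex.norm_image_sub_le_of_norm_hasFDerivWithin_le` on closed balls).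
-/

open Metric Set

noncomputable section

namespace Summit.QuantumFields.YangMills.Theorems.BalabanStepParabolic

namespace SmoothBridge

open Literature.MathematicalPhysics.QuantumFieldTheory

variable {E : Type} [NormedAddCommGroup E] [NormedSpace ℝ E]
  {φ : ℝ → E → ℝ} {Ψ : ℝ → E → E} {A : E →L[ℝ] E}
  {φg : ℝ → E → ℝ} {φy : ℝ → E → (E →L[ℝ] ℝ)} {Ψg : ℝ → E → E} {Ψy : ℝ → E → (E →L[ℝ] E)}
  {b C δ R θ' : ℝ}

/-- Mean value inequality for `F t = φ t y − (t + b t³)` on `[g', g] ⊆ [0, δ]` (basin ball). -/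
theorem phi_seg (h : SmoothHalfChart E φ Ψ A φg φy Ψg Ψy b C δ R θ') {g g' : ℝ} {y : E}
    (hg' : 0 ≤ g') (hle : g' ≤ g) (hg : g ≤ δ) (hy : ‖y‖ ≤ R) :
    |(φ g y - (g + b * g ^ 3)) - (φ g' y - (g' + b * g' ^ 3))| ≤
      C * g ^ 2 * (g + ‖y‖) * (g - g') := by
  have hC := h.C_nonneg
  have hF : ∀ t ∈ Icc g' g, HasDerivWithinAt (fun t => φ t y - (t + b * t ^ 3))
      (φg t y - (1 + 3 * b * t ^ 2)) (Icc g' g) t := by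
    intro t ht
    have ht' : t ∈ Icc 0 δ := ⟨hg'.trans ht.1, ht.2.trans hg⟩
    have h1 := (h.hasDeriv_φ t ht' y hy).mono (Icc_subset_Icc hg' hg)
    have h2 : HasDerivAt (fun t : ℝ => t + b * t ^ 3) (1 + b * (↑(3 : ℕ) * t ^ (3 - 1))) t :=
      (hasDerivAt_id t).add ((hasDerivAt_pow 3 t).const_mul b)
    have h3 : HasDerivWithinAt (fun t : ℝ => t + b * t ^ 3) (1 + 3 * b * t ^ 2) (Icc g' g) t :=
      (h2.congr_deriv (by push_cast; ring)).hasDerivWithinAt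
    exact h1.sub h3
  have hbound : ∀ t ∈ Ico g' g, ‖φg t y - (1 + 3 * b * t ^ 2)‖ ≤ C * g ^ 2 * (g + ‖y‖) := by
    intro t ht
    have ht0 : 0 ≤ t := hg'.trans ht.1
    have htg : t ≤ g := ht.2.le
    have ht' : t ∈ Icc 0 δ := ⟨ht0, htg.trans hg⟩
    rw [Real.norm_eq_abs]
    calc |φg t y - (1 + 3 * b * t ^ 2)| ≤ C * t ^ 2 * (t + ‖y‖) := h.φg_bound t ht' y hy
      _ ≤ C * g ^ 2 * (g + ‖y‖) := by gcongr
  have := norm_image_sub_le_of_norm_deriv_le_segment' hF hbound g ⟨hle, le_rfl⟩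
  rwa [Real.norm_eq_abs] at this

/-- Mean value inequality for `t ↦ Ψ t y` on `[g', g] ⊆ [0, δ]` (chart ball). -/
theorem psi_seg (h : SmoothHalfChart E φ Ψ A φg φy Ψg Ψy b C δ R θ') {g g' : ℝ} {y : E}
    (hg' : 0 ≤ g') (hle : g' ≤ g) (hg : g ≤ δ) (hy : ‖y‖ ≤ δ) :
    ‖Ψ g y - Ψ g' y‖ ≤ C * (g + ‖y‖) * (g - g') := by
  have hC := h.C_nonneg
  have hF : ∀ t ∈ Icc g' g, HasDerivWithinAt (fun t => Ψ t y) (Ψg t y) (Icc g' g) t := fun t ht =>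
    (h.hasDeriv_Ψ t ⟨hg'.trans ht.1, ht.2.trans hg⟩ y hy).mono (Icc_subset_Icc hg' hg)
  have hbound : ∀ t ∈ Ico g' g, ‖Ψg t y‖ ≤ C * (g + ‖y‖) := by
    intro t ht
    have htg : t ≤ g := ht.2.le
    calc ‖Ψg t y‖ ≤ C * (t + ‖y‖) := h.Ψg_bound t ⟨hg'.trans ht.1, htg.trans hg⟩ y hy
      _ ≤ C * (g + ‖y‖) := by gcongr
  exact norm_image_sub_le_of_norm_deriv_le_segment' hF hbound g ⟨hle, le_rfl⟩

/-- Mean value inequality for `φ g ·` on the chart ball. -/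
theorem phi_fib (h : SmoothHalfChart E φ Ψ A φg φy Ψg Ψy b C δ R θ') {g : ℝ} (hg : g ∈ Icc 0 δ)
    {y y' : E} (hy : ‖y‖ ≤ δ) (hy' : ‖y'‖ ≤ δ) :
    |φ g y - φ g y'| ≤ C * g ^ 3 * ‖y - y'‖ := by
  have := (convex_closedBall (0 : E) δ).norm_image_sub_le_of_norm_hasFDerivWithin_le
    (fun z hz => h.hasFDeriv_φ g hg z (mem_closedBall_zero_iff.mp hz))
    (fun z hz => h.φy_bound g hg z (mem_closedBall_zero_iff.mp hz))
    (mem_closedBall_zero_iff.mpr hy') (mem_closedBall_zero_iff.mpr hy)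
  rwa [Real.norm_eq_abs] at this

/-- Mean value inequality for `z ↦ Ψ g z − A z` on the ball of radius `max ‖y‖ ‖y'‖`. -/
theorem psi_fib (h : SmoothHalfChart E φ Ψ A φg φy Ψg Ψy b C δ R θ') {g : ℝ} (hg : g ∈ Icc 0 δ)
    {y y' : E} (hy : ‖y‖ ≤ δ) (hy' : ‖y'‖ ≤ δ) :
    ‖Ψ g y - Ψ g y' - A (y - y')‖ ≤ C * (g + ‖y‖ + ‖y'‖) * ‖y - y'‖ := by
  have hC := h.C_nonneg
  set ρ := max ‖y‖ ‖y'‖ with hρ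
  have hρδ : ρ ≤ δ := max_le hy hy'
  have hρR : ρ ≤ R := hρδ.trans h.δ_le_R
  have hsub : closedBall (0 : E) ρ ⊆ closedBall 0 R := closedBall_subset_closedBall hρR
  have hder : ∀ z ∈ closedBall (0 : E) ρ,
      HasFDerivWithinAt (fun z => Ψ g z - A z) (Ψy g z - A) (closedBall 0 ρ) z := by
    intro z hz
    have hzR : ‖z‖ ≤ R := (mem_closedBall_zero_iff.mp hz).trans hρR
    exact ((h.hasFDeriv_Ψ g hg z hzR).mono hsub).sub A.hasFDerivWithinAt
  have hbound : ∀ z ∈ closedBall (0 : E) ρ, ‖Ψy g z - A‖ ≤ C * (g + ‖y‖ + ‖y'‖) := by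
    intro z hz
    have hzρ : ‖z‖ ≤ ρ := mem_closedBall_zero_iff.mp hz
    have hz2 : ‖z‖ ≤ ‖y‖ + ‖y'‖ := hzρ.trans
      (max_le (le_add_of_nonneg_right (norm_nonneg _)) (le_add_of_nonneg_left (norm_nonneg _)))
    calc ‖Ψy g z - A‖ ≤ C * (g + ‖z‖) := h.Ψy_sub_A g hg z (hzρ.trans hρδ)
      _ ≤ C * (g + (‖y‖ + ‖y'‖)) := by gcongr
      _ = C * (g + ‖y‖ + ‖y'‖) := by ring
  have := (convex_closedBall (0 : E) ρ).norm_image_sub_le_of_norm_hasFDerivWithin_le hder hbound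
    (mem_closedBall_zero_iff.mpr (le_max_right _ _)) (mem_closedBall_zero_iff.mpr (le_max_left _ _))
  calc ‖Ψ g y - Ψ g y' - A (y - y')‖ = ‖(Ψ g y - A y) - (Ψ g y' - A y')‖ := by
        rw [map_sub]; congr 1; abel
    _ ≤ C * (g + ‖y‖ + ‖y'‖) * ‖y - y'‖ := this

/-- Uniform contraction of `Ψ g ·` on the basin ball. -/
theorem psi_con (h : SmoothHalfChart E φ Ψ A φg φy Ψg Ψy b C δ R θ') {g : ℝ} (hg : g ∈ Icc 0 δ)
    {y y' : E} (hy : ‖y‖ ≤ R) (hy' : ‖y'‖ ≤ R) :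
    ‖Ψ g y - Ψ g y'‖ ≤ θ' * ‖y - y'‖ :=
  (convex_closedBall (0 : E) R).norm_image_sub_le_of_norm_hasFDerivWithin_le
    (fun z hz => h.hasFDeriv_Ψ g hg z (mem_closedBall_zero_iff.mp hz))
    (fun z hz => h.Ψy_bound g hg z (mem_closedBall_zero_iff.mp hz))
    (mem_closedBall_zero_iff.mpr hy') (mem_closedBall_zero_iff.mpr hy)

/-- The second-order remainder of the fibre map on the chart. -/
theorem psi_rem (h : SmoothHalfChart E φ Ψ A φg φy Ψg Ψy b C δ R θ') {g : ℝ} (hg : g ∈ Icc 0 δ)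
    {y : E} (hy : ‖y‖ ≤ δ) :
    ‖Ψ g y - A y‖ ≤ (2 * C + 1) * (g ^ 2 + ‖y‖ ^ 2) := by
  have hC := h.C_nonneg
  have h1 : ‖Ψ g y - Ψ 0 y‖ ≤ C * (g + ‖y‖) * (g - 0) := psi_seg h le_rfl hg.1 hg.2 hy
  have h2 : ‖Ψ 0 y - Ψ 0 0 - A (y - 0)‖ ≤ C * (0 + ‖y‖ + ‖(0 : E)‖) * ‖y - 0‖ :=
    psi_fib h ⟨le_rfl, h.δ_pos.le⟩ hy (by simpa using h.δ_pos.le)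
  rw [h.Ψ_zero_zero] at h2
  simp only [sub_zero, norm_zero, zero_add, add_zero] at h1 h2
  have hg0 := hg.1
  have hy0 := norm_nonneg y
  calc ‖Ψ g y - A y‖ = ‖(Ψ g y - Ψ 0 y) + (Ψ 0 y - A y)‖ := by congr 1; abel
    _ ≤ ‖Ψ g y - Ψ 0 y‖ + ‖Ψ 0 y - A y‖ := norm_add_le _ _
    _ ≤ C * (g + ‖y‖) * g + C * ‖y‖ * ‖y‖ := add_le_add h1 h2
    _ ≤ (2 * C + 1) * (g ^ 2 + ‖y‖ ^ 2) := by
        nlinarith [sq_nonneg (g - ‖y‖), mul_nonneg hC (mul_nonneg hg0 hy0), sq_nonneg g, sq_nonneg ‖y‖]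

/-- The first-order remainder of the coupling map on the basin. -/
theorem phi_rem (h : SmoothHalfChart E φ Ψ A φg φy Ψg Ψy b C δ R θ') {g : ℝ} (hg : g ∈ Icc 0 δ)
    {y : E} (hy : ‖y‖ ≤ R) :
    |φ g y - (g + b * g ^ 3)| ≤ C * (g ^ 4 + g ^ 3 * ‖y‖) := by
  have := phi_seg h le_rfl hg.1 hg.2 hy
  rw [h.φ_zero y hy] at this
  have e1 : φ g y - (g + b * g ^ 3) - (0 - (0 + b * 0 ^ 3)) = φ g y - (g + b * g ^ 3) := by ring
  have e2 : C * g ^ 2 * (g + ‖y‖) * (g - 0) = C * (g ^ 4 + g ^ 3 * ‖y‖) := by ring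
  rwa [e1, e2] at this

/-! #### The odd extension of the coupling map -/

/-- `φ' g y = φ g y` for `g ≥ 0`, `−φ (−g) y` for `g < 0`. -/
def oddExt (φ : ℝ → E → ℝ) (g : ℝ) (y : E) : ℝ := if 0 ≤ g then φ g y else -φ (-g) y

omit [NormedAddCommGroup E] [NormedSpace ℝ E] in
theorem oddExt_of_nonneg {g : ℝ} (hg : 0 ≤ g) (y : E) : oddExt φ g y = φ g y := if_pos hg

omit [NormedAddCommGroup E] [NormedSpace ℝ E] in
theorem oddExt_neg_of_pos {t : ℝ} (ht : 0 < t) (y : E) : oddExt φ (-t) y = -φ t y := by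
  rw [oddExt, if_neg (by linarith), neg_neg]

/-- Monotonicity of the `lipschitz_base` bound in the coupling size. -/
theorem mono_aux {C a m s d d' : ℝ} (hC : 0 ≤ C) (ha : 0 ≤ a) (ham : a ≤ m) (hs : 0 ≤ s)
    (hd : 0 ≤ d) (hdd : d ≤ d') :
    C * a ^ 2 * (a + s) * d ≤ C * m ^ 2 * (m + s) * d' := by
  have hm : 0 ≤ m := ha.trans ham
  have h1 : a ^ 2 ≤ m ^ 2 := by gcongr
  have h2 : a + s ≤ m + s := by linarith
  apply mul_le_mul _ hdd hd (by positivity)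
  apply mul_le_mul _ h2 (by positivity) (by positivity)
  exact mul_le_mul_of_nonneg_left h1 hC

/-- `lipschitz_base` for the odd extension, in the ordered case `g' ≤ g`. -/
theorem base_phi (h : SmoothHalfChart E φ Ψ A φg φy Ψg Ψy b C δ R θ') {g g' : ℝ} {y : E}
    (hg : |g| ≤ δ) (hg' : |g'| ≤ δ) (hy : ‖y‖ ≤ δ) (hle : g' ≤ g) :
    |oddExt φ g y - oddExt φ g' y - (g - g') - b * (g ^ 3 - g' ^ 3)| ≤
      C * max |g| |g'| ^ 2 * (max |g| |g'| + ‖y‖) * |g - g'| := by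
  have hC := h.C_nonneg
  have hyR : ‖y‖ ≤ R := hy.trans h.δ_le_R
  have hy0 := norm_nonneg y
  rcases le_or_gt 0 g' with hg'0 | hg'neg
  · -- both nonnegative
    have hg0 : 0 ≤ g := hg'0.trans hle
    have e1 : |g| = g := abs_of_nonneg hg0
    have e2 : |g'| = g' := abs_of_nonneg hg'0
    have e3 : |g - g'| = g - g' := abs_of_nonneg (sub_nonneg.mpr hle)
    rw [e1] at hg
    rw [oddExt_of_nonneg hg0, oddExt_of_nonneg hg'0, e1, e2, e3, max_eq_left hle]
    have key := phi_seg h hg'0 hle hg hyR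
    calc |φ g y - φ g' y - (g - g') - b * (g ^ 3 - g' ^ 3)|
        = |(φ g y - (g + b * g ^ 3)) - (φ g' y - (g' + b * g' ^ 3))| := by ring_nf
      _ ≤ C * g ^ 2 * (g + ‖y‖) * (g - g') := key
  · rcases lt_or_ge g 0 with hgneg | hg0
    · -- both negative: g = -t, g' = -t', 0 < t ≤ t'
      obtain ⟨t, rfl⟩ : ∃ t, g = -t := ⟨-g, (neg_neg g).symm⟩
      obtain ⟨t', rfl⟩ : ∃ t', g' = -t' := ⟨-g', (neg_neg g').symm⟩
      have ht : 0 < t := by linarith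
      have ht' : 0 < t' := by linarith
      have htt : t ≤ t' := by linarith
      have e1 : |(-t)| = t := by rw [abs_neg, abs_of_pos ht]
      have e2 : |(-t')| = t' := by rw [abs_neg, abs_of_pos ht']
      have e3 : |(-t) - -t'| = t' - t := by
        rw [show -t - -t' = t' - t by ring, abs_of_nonneg (by linarith)]
      rw [e1] at hg
      rw [e2] at hg'
      rw [oddExt_neg_of_pos ht, oddExt_neg_of_pos ht', e1, e2, e3, max_eq_right htt]
      have key := phi_seg h ht.le htt hg' hyR
      calc |-φ t y - -φ t' y - (-t - -t') - b * ((-t) ^ 3 - (-t') ^ 3)|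
          = |(φ t' y - (t' + b * t' ^ 3)) - (φ t y - (t + b * t ^ 3))| := by ring_nf
        _ ≤ C * t' ^ 2 * (t' + ‖y‖) * (t' - t) := key
    · -- g' < 0 ≤ g: g' = -t'
      obtain ⟨t', rfl⟩ : ∃ t', g' = -t' := ⟨-g', (neg_neg g').symm⟩
      have ht' : 0 < t' := by linarith
      have e1 : |g| = g := abs_of_nonneg hg0
      have e2 : |(-t')| = t' := by rw [abs_neg, abs_of_pos ht']
      have e3 : |g - -t'| = g + t' := by rw [sub_neg_eq_add, abs_of_nonneg (by linarith)]
      rw [e1] at hg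
      rw [e2] at hg'
      rw [oddExt_of_nonneg hg0, oddExt_neg_of_pos ht', e1, e2, e3]
      set m := max g t' with hm
      have hgm : g ≤ m := le_max_left _ _
      have htm : t' ≤ m := le_max_right _ _
      have k1 := phi_rem h ⟨hg0, hg⟩ hyR
      have k2 := phi_rem h ⟨ht'.le, hg'⟩ hyR
      have m1 : C * g ^ 2 * (g + ‖y‖) * g ≤ C * m ^ 2 * (m + ‖y‖) * g :=
        mono_aux hC hg0 hgm hy0 hg0 le_rfl
      have m2 : C * t' ^ 2 * (t' + ‖y‖) * t' ≤ C * m ^ 2 * (m + ‖y‖) * t' :=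
        mono_aux hC ht'.le htm hy0 ht'.le le_rfl
      calc |φ g y - -φ t' y - (g - -t') - b * (g ^ 3 - (-t') ^ 3)|
          = |(φ g y - (g + b * g ^ 3)) + (φ t' y - (t' + b * t' ^ 3))| := by ring_nf
        _ ≤ |φ g y - (g + b * g ^ 3)| + |φ t' y - (t' + b * t' ^ 3)| := abs_add_le _ _
        _ ≤ C * (g ^ 4 + g ^ 3 * ‖y‖) + C * (t' ^ 4 + t' ^ 3 * ‖y‖) := add_le_add k1 k2
        _ = C * g ^ 2 * (g + ‖y‖) * g + C * t' ^ 2 * (t' + ‖y‖) * t' := by ring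
        _ ≤ C * m ^ 2 * (m + ‖y‖) * g + C * m ^ 2 * (m + ‖y‖) * t' := add_le_add m1 m2
        _ = C * m ^ 2 * (m + ‖y‖) * (g + t') := by ring

/-- `lipschitz_base` for the even extension of the fibre map. -/
theorem base_psi (h : SmoothHalfChart E φ Ψ A φg φy Ψg Ψy b C δ R θ') {g g' : ℝ} {y : E}
    (hg : |g| ≤ δ) (hg' : |g'| ≤ δ) (hy : ‖y‖ ≤ δ) :
    ‖Ψ |g| y - Ψ |g'| y‖ ≤ C * (|g| + |g'| + ‖y‖) * |g - g'| := by
  have hC := h.C_nonneg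
  rcases le_total |g'| |g| with hle | hle
  · have h1 := psi_seg h (abs_nonneg _) hle hg hy
    have h2 : |g| - |g'| ≤ |g - g'| := abs_sub_abs_le_abs_sub g g'
    have h3 : C * (|g| + ‖y‖) ≤ C * (|g| + |g'| + ‖y‖) :=
      mul_le_mul_of_nonneg_left (by linarith [abs_nonneg g']) hC
    exact h1.trans (mul_le_mul h3 h2 (sub_nonneg.mpr hle) (by positivity))
  · rw [norm_sub_rev]
    have h1 := psi_seg h (abs_nonneg _) hle hg' hy
    have h2 : |g'| - |g| ≤ |g - g'| := by rw [abs_sub_comm g g']; exact abs_sub_abs_le_abs_sub g' g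
    have h3 : C * (|g'| + ‖y‖) ≤ C * (|g| + |g'| + ‖y‖) :=
      mul_le_mul_of_nonneg_left (by linarith [abs_nonneg g]) hC
    exact h1.trans (mul_le_mul h3 h2 (sub_nonneg.mpr hle) (by positivity))

end SmoothBridge

open SmoothBridge Literature.MathematicalPhysics.QuantumFieldTheory in
/-- **Stub 2 — smooth half-chart ⇒ verbatim Lipschitz block** (`ParabolicBlockOfSmooth`, TRUE as typed).
[folklore] -/
theorem parabolicBlockOfSmooth :
    ∀ (E : Type) [NormedAddCommGroup E] [NormedSpace ℝ E]
      (φ : ℝ → E → ℝ) (Ψ : ℝ → E → E) (A : E →L[ℝ] E)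
      (φg : ℝ → E → ℝ) (φy : ℝ → E → (E →L[ℝ] ℝ)) (Ψg : ℝ → E → E) (Ψy : ℝ → E → (E →L[ℝ] E))
      (b C δ R θ' : ℝ),
      SmoothHalfChart E φ Ψ A φg φy Ψg Ψy b C δ R θ' →
      ∃ (φ' : ℝ → E → ℝ) (Ψ' : ℝ → E → E) (C' : ℝ), 0 < C' ∧
        (∀ g : ℝ, 0 ≤ g → ∀ y : E, φ' g y = φ g y ∧ Ψ' g y = Ψ g y) ∧
        ParabolicBlock E φ' Ψ' A b C' δ ∧ BasinBlock E φ' Ψ' b C' δ R θ' := by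
  intro E _ _ φ Ψ A φg φy Ψg Ψy b C δ R θ' h
  have hC := h.C_nonneg
  have hCC : C ≤ 2 * C + 1 := by linarith
  have hC' : (0 : ℝ) ≤ 2 * C + 1 := by linarith
  -- reduction of the odd extension to `t = |g|`
  have red_rem : ∀ (g : ℝ) (y : E),
      |oddExt φ g y - (g + b * g ^ 3)| = |φ |g| y - (|g| + b * |g| ^ 3)| := by
    intro g y
    rcases le_or_gt 0 g with hg0 | hgneg
    · rw [oddExt_of_nonneg hg0, abs_of_nonneg hg0]
    · obtain ⟨t, rfl⟩ : ∃ t, g = -t := ⟨-g, (neg_neg g).symm⟩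
      have ht : 0 < t := by linarith
      rw [oddExt_neg_of_pos ht, abs_neg, abs_of_pos ht]
      rw [show -φ t y - (-t + b * (-t) ^ 3) = -(φ t y - (t + b * t ^ 3)) by ring, abs_neg]
  have red_fib : ∀ (g : ℝ) (y y' : E),
      |oddExt φ g y - oddExt φ g y'| = |φ |g| y - φ |g| y'| := by
    intro g y y'
    rcases le_or_gt 0 g with hg0 | hgneg
    · rw [oddExt_of_nonneg hg0, oddExt_of_nonneg hg0, abs_of_nonneg hg0]
    · obtain ⟨t, rfl⟩ : ∃ t, g = -t := ⟨-g, (neg_neg g).symm⟩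
      have ht : 0 < t := by linarith
      rw [oddExt_neg_of_pos ht, oddExt_neg_of_pos ht, abs_neg, abs_of_pos ht]
      rw [show -φ t y - -φ t y' = -(φ t y - φ t y') by ring, abs_neg]
  have habs : ∀ {g : ℝ}, |g| ≤ δ → |g| ∈ Icc 0 δ := fun hg => ⟨abs_nonneg _, hg⟩
  refine ⟨oddExt φ, fun g y => Ψ |g| y, 2 * C + 1, by linarith, ?_, ⟨?_, ?_, ?_⟩, ⟨?_, ?_⟩⟩
  · intro g hg y
    exact ⟨oddExt_of_nonneg hg y, by simp only [abs_of_nonneg hg]⟩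
  · -- remainder
    intro g y hg hy
    have e4 : |g| ^ 4 = g ^ 4 := by rw [pow_abs]; exact abs_of_nonneg (by positivity)
    refine ⟨?_, ?_⟩
    · rw [red_rem]
      calc |φ |g| y - (|g| + b * |g| ^ 3)| ≤ C * (|g| ^ 4 + |g| ^ 3 * ‖y‖) :=
            phi_rem h (habs hg) (hy.trans h.δ_le_R)
        _ = C * (g ^ 4 + |g| ^ 3 * ‖y‖) := by rw [e4]
        _ ≤ (2 * C + 1) * (g ^ 4 + |g| ^ 3 * ‖y‖) := by gcongr
    · calc ‖Ψ |g| y - A y‖ ≤ (2 * C + 1) * (|g| ^ 2 + ‖y‖ ^ 2) := psi_rem h (habs hg) hy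
        _ = (2 * C + 1) * (g ^ 2 + ‖y‖ ^ 2) := by rw [sq_abs]
  · -- lipschitz_fibre
    intro g y y' hg hy hy'
    refine ⟨?_, ?_⟩
    · rw [red_fib]
      calc |φ |g| y - φ |g| y'| ≤ C * |g| ^ 3 * ‖y - y'‖ := phi_fib h (habs hg) hy hy'
        _ ≤ (2 * C + 1) * |g| ^ 3 * ‖y - y'‖ := by gcongr
    · calc ‖Ψ |g| y - Ψ |g| y' - A (y - y')‖ ≤ C * (|g| + ‖y‖ + ‖y'‖) * ‖y - y'‖ :=
            psi_fib h (habs hg) hy hy'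
        _ ≤ (2 * C + 1) * (|g| + ‖y‖ + ‖y'‖) * ‖y - y'‖ := by gcongr
  · -- lipschitz_base
    intro g g' y hg hg' hy
    refine ⟨?_, ?_⟩
    · have hmono : C * max |g| |g'| ^ 2 * (max |g| |g'| + ‖y‖) * |g - g'| ≤
          (2 * C + 1) * max |g| |g'| ^ 2 * (max |g| |g'| + ‖y‖) * |g - g'| := by
        have : 0 ≤ max |g| |g'| := (abs_nonneg g).trans (le_max_left _ _)
        gcongr
      rcases le_total g' g with hle | hle
      · exact (base_phi h hg hg' hy hle).trans hmono
      · have key := base_phi h hg' hg hy hle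
        have e1 : max |g'| |g| = max |g| |g'| := max_comm _ _
        have e2 : |g' - g| = |g - g'| := abs_sub_comm _ _
        have e3 : |oddExt φ g y - oddExt φ g' y - (g - g') - b * (g ^ 3 - g' ^ 3)| =
            |oddExt φ g' y - oddExt φ g y - (g' - g) - b * (g' ^ 3 - g ^ 3)| := by
          rw [← abs_neg]; congr 1; ring
        rw [e3]
        rw [e1, e2] at key
        exact key.trans hmono
    · calc ‖Ψ |g| y - Ψ |g'| y‖ ≤ C * (|g| + |g'| + ‖y‖) * |g - g'| := base_psi h hg hg' hy
        _ ≤ (2 * C + 1) * (|g| + |g'| + ‖y‖) * |g - g'| := by gcongr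
  · -- contraction on the basin
    intro g y y' hg hy hy'
    exact psi_con h (habs hg) hy hy'
  · -- remainder on the basin
    intro g y hg hy
    have e4 : |g| ^ 4 = g ^ 4 := by rw [pow_abs]; exact abs_of_nonneg (by positivity)
    rw [red_rem]
    calc |φ |g| y - (|g| + b * |g| ^ 3)| ≤ C * (|g| ^ 4 + |g| ^ 3 * ‖y‖) := phi_rem h (habs hg) hy
      _ = C * (g ^ 4 + |g| ^ 3 * ‖y‖) := by rw [e4]
      _ ≤ (2 * C + 1) * (g ^ 4 + |g| ^ 3 * ‖y‖) := by gcongr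

end Summit.QuantumFields.YangMills.Theorems.BalabanStepParabolic

end


/-!
# `stub_realisation` of line `perfect-action-regulator-chart` (crux `BalabanStepParabolic`) — candidate proof

Refuter drefute certificate (refuter-drefute-stmt-QuantumFields-9684-0): the registered stub statement
`RealisationFromChartObservables` (skeleton v3, stated in full) is TRUE as typed. Witness exactly as in the stub
docstring: chart `Ê = E × (ℝ × E)` (sup norm), `φ̂ g (y,s,w) = φ g y`, `Ψ̂ g (y,s,w) = (Ψ g y, g²/2, y/2)`,
`Â = (A ∘ fst, 0, fst/2)`, constants `max θ ½`, `max θ' ½`, `max C ½`, Wilson arc `(yW g, 0, 0)`, normalisations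
`Negative.cInd r`, realisation functional by the in-chart / decoded-preimage case split.
-/

open scoped SchwartzMap
open MeasureTheory Filter Topology
open Literature.MathematicalPhysics.AQFT Literature.MathematicalPhysics.QuantumLattice
open Literature.Probability.LatticeModels
open Literature.MathematicalPhysics.QuantumFieldTheory

noncomputable section

namespace Summit.QuantumFields.YangMills.Theorems.BalabanStepParabolic

namespace RealisationBridge

section Chart

variable {E : Type} [NormedAddCommGroup E] [NormedSpace ℝ E]

omit [NormedSpace ℝ E] in
/-- Sup-norm bound for a triple. -/
theorem norm_triple_le {a w : E} {s K : ℝ} (ha : ‖a‖ ≤ K) (hs : |s| ≤ K) (hw : ‖w‖ ≤ K) :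
    ‖(a, (s, w))‖ ≤ K := by
  rw [Prod.norm_mk, Prod.norm_mk, Real.norm_eq_abs]
  exact max_le ha (max_le hs hw)

omit [NormedSpace ℝ E] in
theorem norm_fst_sub_le (x x' : E × (ℝ × E)) : ‖x.1 - x'.1‖ ≤ ‖x - x'‖ := by
  rw [← Prod.fst_sub]; exact norm_fst_le _

/-- The injectivised fibre map `Ψ̂ g (y, s, w) = (Ψ g y, g²/2, y/2)`. -/
def hatΨ (Ψ : ℝ → E → E) (g : ℝ) (x : E × (ℝ × E)) : E × (ℝ × E) :=
  (Ψ g x.1, ((1 / 2 : ℝ) * g ^ 2, (1 / 2 : ℝ) • x.1))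

/-- Its linear part `Â (y, s, w) = (A y, 0, y/2)`. -/
def hatA (A : E →L[ℝ] E) : E × (ℝ × E) →L[ℝ] E × (ℝ × E) :=
  (A.comp (ContinuousLinearMap.fst ℝ E (ℝ × E))).prod
    ((0 : E × (ℝ × E) →L[ℝ] ℝ).prod ((1 / 2 : ℝ) • ContinuousLinearMap.fst ℝ E (ℝ × E)))

@[simp] theorem hatA_apply (A : E →L[ℝ] E) (x : E × (ℝ × E)) :
    hatA A x = (A x.1, (0, (1 / 2 : ℝ) • x.1)) := rfl

@[simp] theorem hatΨ_apply (Ψ : ℝ → E → E) (g : ℝ) (x : E × (ℝ × E)) :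
    hatΨ Ψ g x = (Ψ g x.1, ((1 / 2 : ℝ) * g ^ 2, (1 / 2 : ℝ) • x.1)) := rfl

theorem norm_hatA_le (A : E →L[ℝ] E) {θ : ℝ} (hA : ‖A‖ ≤ θ) : ‖hatA A‖ ≤ max θ (1 / 2) := by
  have hθ : 0 ≤ θ := (norm_nonneg A).trans hA
  refine ContinuousLinearMap.opNorm_le_bound _ (le_max_of_le_right (by norm_num)) fun x => ?_
  rw [hatA_apply]
  have hx1 : ‖x.1‖ ≤ ‖x‖ := norm_fst_le x
  have hm : 0 ≤ max θ (1 / 2) * ‖x‖ := by positivity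
  refine norm_triple_le ?_ (by simp) ?_
  · calc ‖A x.1‖ ≤ ‖A‖ * ‖x.1‖ := A.le_opNorm _
      _ ≤ θ * ‖x‖ := mul_le_mul hA hx1 (norm_nonneg _) hθ
      _ ≤ max θ (1 / 2) * ‖x‖ := by gcongr; exact le_max_left _ _
  · rw [norm_smul, Real.norm_eq_abs, abs_of_pos (by norm_num : (0 : ℝ) < 1 / 2)]
    calc (1 / 2 : ℝ) * ‖x.1‖ ≤ (1 / 2) * ‖x‖ := by gcongr
      _ ≤ max θ (1 / 2) * ‖x‖ := by gcongr; exact le_max_right _ _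

variable {φ : ℝ → E → ℝ} {Ψ : ℝ → E → E} {A : E →L[ℝ] E} {b C δ R θ' : ℝ}

/-- The parabolic block transfers to the injectivised chart with constant `max C ½`. -/
theorem hat_parabolicBlock (hPB : ParabolicBlock E φ Ψ A b C δ) (hC : 0 ≤ C) :
    ParabolicBlock (E × (ℝ × E)) (fun g x => φ g x.1) (hatΨ Ψ) (hatA A) b (max C (1 / 2)) δ := by
  obtain ⟨hrem, hfib, hbase⟩ := hPB
  have hCle : C ≤ max C (1 / 2) := le_max_left _ _
  have hεle : (1 / 2 : ℝ) ≤ max C (1 / 2) := le_max_right _ _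
  have hC0 : 0 ≤ max C (1 / 2) := hC.trans hCle
  refine ⟨fun g x hg hx => ?_, fun g x x' hg hx hx' => ?_, fun g g' x hg hg' hx => ?_⟩
  · -- remainder
    have hx1 : ‖x.1‖ ≤ ‖x‖ := norm_fst_le x
    obtain ⟨h1, h2⟩ := hrem g x.1 hg (hx1.trans hx)
    refine ⟨h1.trans ?_, ?_⟩
    · have h3 : 0 ≤ |g| ^ 3 := by positivity
      calc C * (g ^ 4 + |g| ^ 3 * ‖x.1‖) ≤ C * (g ^ 4 + |g| ^ 3 * ‖x‖) := by gcongr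
        _ ≤ max C (1 / 2) * (g ^ 4 + |g| ^ 3 * ‖x‖) := by gcongr
    · have heq : hatΨ Ψ g x - hatA A x = (Ψ g x.1 - A x.1, ((1 / 2 : ℝ) * g ^ 2, 0)) := by
        simp [hatΨ]
      rw [heq]
      have hsq : g ^ 2 ≤ g ^ 2 + ‖x‖ ^ 2 := by nlinarith [norm_nonneg x]
      refine norm_triple_le ?_ ?_ ?_
      · calc ‖Ψ g x.1 - A x.1‖ ≤ C * (g ^ 2 + ‖x.1‖ ^ 2) := h2
          _ ≤ C * (g ^ 2 + ‖x‖ ^ 2) := by gcongr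
          _ ≤ max C (1 / 2) * (g ^ 2 + ‖x‖ ^ 2) := by gcongr
      · rw [abs_of_nonneg (by positivity)]
        calc (1 / 2 : ℝ) * g ^ 2 ≤ max C (1 / 2) * g ^ 2 := by gcongr
          _ ≤ max C (1 / 2) * (g ^ 2 + ‖x‖ ^ 2) := by gcongr
      · rw [norm_zero]; positivity
  · -- lipschitz_fibre
    have hx1 : ‖x.1‖ ≤ ‖x‖ := norm_fst_le x
    have hx1' : ‖x'.1‖ ≤ ‖x'‖ := norm_fst_le x'
    have hd : ‖x.1 - x'.1‖ ≤ ‖x - x'‖ := norm_fst_sub_le x x'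
    obtain ⟨h1, h2⟩ := hfib g x.1 x'.1 hg (hx1.trans hx) (hx1'.trans hx')
    refine ⟨?_, ?_⟩
    · show |φ g x.1 - φ g x'.1| ≤ max C (1 / 2) * |g| ^ 3 * ‖x - x'‖
      have h3 : 0 ≤ |g| ^ 3 := by positivity
      calc |φ g x.1 - φ g x'.1| ≤ C * |g| ^ 3 * ‖x.1 - x'.1‖ := h1
        _ ≤ C * |g| ^ 3 * ‖x - x'‖ := by gcongr
        _ ≤ max C (1 / 2) * |g| ^ 3 * ‖x - x'‖ := by gcongr
    · have heq : hatΨ Ψ g x - hatΨ Ψ g x' - hatA A (x - x') =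
          (Ψ g x.1 - Ψ g x'.1 - A (x.1 - x'.1), (0, 0)) := by
        simp [hatΨ, smul_sub, Prod.ext_iff]
      rw [heq]
      have hK : 0 ≤ max C (1 / 2) * (|g| + ‖x‖ + ‖x'‖) * ‖x - x'‖ := by positivity
      refine norm_triple_le ?_ (by simpa using hK) (by simpa using hK)
      calc ‖Ψ g x.1 - Ψ g x'.1 - A (x.1 - x'.1)‖ ≤ C * (|g| + ‖x.1‖ + ‖x'.1‖) * ‖x.1 - x'.1‖ := h2
        _ ≤ C * (|g| + ‖x‖ + ‖x'‖) * ‖x - x'‖ := by gcongr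
        _ ≤ max C (1 / 2) * (|g| + ‖x‖ + ‖x'‖) * ‖x - x'‖ := by gcongr
  · -- lipschitz_base
    have hx1 : ‖x.1‖ ≤ ‖x‖ := norm_fst_le x
    obtain ⟨h1, h2⟩ := hbase g g' x.1 hg hg' (hx1.trans hx)
    have hm0 : 0 ≤ max |g| |g'| := le_max_of_le_left (abs_nonneg g)
    refine ⟨?_, ?_⟩
    · show |φ g x.1 - φ g' x.1 - (g - g') - b * (g ^ 3 - g' ^ 3)| ≤
          max C (1 / 2) * max |g| |g'| ^ 2 * (max |g| |g'| + ‖x‖) * |g - g'|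
      refine h1.trans ?_
      gcongr
    · have heq : hatΨ Ψ g x - hatΨ Ψ g' x =
          (Ψ g x.1 - Ψ g' x.1, ((1 / 2 : ℝ) * ((g + g') * (g - g')), 0)) := by
        simp [hatΨ, Prod.ext_iff]; ring
      rw [heq]
      have hK : 0 ≤ max C (1 / 2) * (|g| + |g'| + ‖x‖) * |g - g'| := by positivity
      refine norm_triple_le ?_ ?_ (by simpa using hK)
      · refine h2.trans ?_
        gcongr
      · rw [abs_mul, abs_mul, abs_of_pos (by norm_num : (0 : ℝ) < 1 / 2)]
        calc (1 / 2 : ℝ) * (|g + g'| * |g - g'|) ≤ (1 / 2) * ((|g| + |g'| + ‖x‖) * |g - g'|) := by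
              gcongr
              exact (abs_add_le g g').trans (le_add_of_nonneg_right (norm_nonneg _))
          _ = (1 / 2) * (|g| + |g'| + ‖x‖) * |g - g'| := by ring
          _ ≤ max C (1 / 2) * (|g| + |g'| + ‖x‖) * |g - g'| := by gcongr

/-- The basin block transfers with contraction rate `max θ' ½` and constant `max C ½`. -/
theorem hat_basinBlock (hBB : BasinBlock E φ Ψ b C δ R θ') (hC : 0 ≤ C) (hθ' : 0 ≤ θ') :
    BasinBlock (E × (ℝ × E)) (fun g x => φ g x.1) (hatΨ Ψ) b (max C (1 / 2)) δ R (max θ' (1 / 2)) := by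
  obtain ⟨hcon, hrem⟩ := hBB
  refine ⟨fun g x x' hg hx hx' => ?_, fun g x hg hx => ?_⟩
  · have hx1 : ‖x.1‖ ≤ ‖x‖ := norm_fst_le x
    have hx1' : ‖x'.1‖ ≤ ‖x'‖ := norm_fst_le x'
    have hd : ‖x.1 - x'.1‖ ≤ ‖x - x'‖ := norm_fst_sub_le x x'
    have h := hcon g x.1 x'.1 hg (hx1.trans hx) (hx1'.trans hx')
    have heq : hatΨ Ψ g x - hatΨ Ψ g x' = (Ψ g x.1 - Ψ g x'.1, (0, (1 / 2 : ℝ) • (x.1 - x'.1))) := by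
      simp [hatΨ, smul_sub]
    rw [heq]
    have hK : 0 ≤ max θ' (1 / 2) * ‖x - x'‖ := by positivity
    refine norm_triple_le ?_ (by simp) ?_
    · calc ‖Ψ g x.1 - Ψ g x'.1‖ ≤ θ' * ‖x.1 - x'.1‖ := h
        _ ≤ θ' * ‖x - x'‖ := by gcongr
        _ ≤ max θ' (1 / 2) * ‖x - x'‖ := by gcongr; exact le_max_left _ _
    · rw [norm_smul, Real.norm_eq_abs, abs_of_pos (by norm_num : (0 : ℝ) < 1 / 2)]
      calc (1 / 2 : ℝ) * ‖x.1 - x'.1‖ ≤ (1 / 2) * ‖x - x'‖ := by gcongr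
        _ ≤ max θ' (1 / 2) * ‖x - x'‖ := by gcongr; exact le_max_right _ _
  · have hx1 : ‖x.1‖ ≤ ‖x‖ := norm_fst_le x
    have h := hrem g x.1 hg (hx1.trans hx)
    show |φ g x.1 - (g + b * g ^ 3)| ≤ max C (1 / 2) * (g ^ 4 + |g| ^ 3 * ‖x‖)
    refine h.trans ?_
    have h3 : 0 ≤ |g| ^ 3 := by positivity
    calc C * (g ^ 4 + |g| ^ 3 * ‖x.1‖) ≤ C * (g ^ 4 + |g| ^ 3 * ‖x‖) := by gcongr
      _ ≤ max C (1 / 2) * (g ^ 4 + |g| ^ 3 * ‖x‖) := by gcongr; exact le_max_left _ _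

end Chart

/-! ### The realisation functional on the injectivised chart -/

section Expect

variable {G : Type} [Group G] [TopologicalSpace G] [IsTopologicalGroup G] [CompactSpace G]
  [MeasurableSpace G] [BorelSpace G] (r : LatticeRep G) (M : ℕ)
  {E : Type} [NormedAddCommGroup E] [NormedSpace ℝ E]
  (δ R : ℝ) (corr : ℝ × E → ℕ → (n : ℕ) → (Fin n → 𝓢(EuclideanSpace ℝ (Fin 4), ℝ)) → ℝ)

open Classical in
/-- `expect (g', (y', s', w')) S n σ f`: `0` on mixed species strings; `corr (g', y') S n f` in the chart;
the decoded preimage value `corr (√(2 s'), 2 w') (M S) n (blockDilate M ∘ f)` out of the chart. -/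
def hatExpect (p : ℝ × (E × (ℝ × E))) (S : ℕ) (n : ℕ) (σ : Fin n → YMSpecies G)
    (f : Fin n → 𝓢(EuclideanSpace ℝ (Fin 4), ℝ)) : ℝ :=
  if (∃ i, σ i ≠ r.curvature) then 0
  else if p.1 ∈ Set.Icc 0 δ ∧ ‖p.2.1‖ ≤ R then corr (p.1, p.2.1) S n f
  else corr (Real.sqrt (2 * p.2.2.1), (2 : ℝ) • p.2.2.2) (M * S) n (fun i => blockDilate M (f i))

variable {r M δ R corr}

theorem hatExpect_of_mixed {p : ℝ × (E × (ℝ × E))} {S n : ℕ} {σ : Fin n → YMSpecies G}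
    (h : ∃ i, σ i ≠ r.curvature) (f : Fin n → 𝓢(EuclideanSpace ℝ (Fin 4), ℝ)) :
    hatExpect r M δ R corr p S n σ f = 0 := by
  unfold hatExpect; rw [if_pos h]

theorem hatExpect_of_mem {p : ℝ × (E × (ℝ × E))} {S n : ℕ} {σ : Fin n → YMSpecies G}
    (h : ¬ ∃ i, σ i ≠ r.curvature) (hp : p.1 ∈ Set.Icc 0 δ ∧ ‖p.2.1‖ ≤ R)
    (f : Fin n → 𝓢(EuclideanSpace ℝ (Fin 4), ℝ)) :
    hatExpect r M δ R corr p S n σ f = corr (p.1, p.2.1) S n f := by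
  unfold hatExpect; rw [if_neg h, if_pos hp]

theorem hatExpect_of_not_mem {p : ℝ × (E × (ℝ × E))} {S n : ℕ} {σ : Fin n → YMSpecies G}
    (h : ¬ ∃ i, σ i ≠ r.curvature) (hp : ¬ (p.1 ∈ Set.Icc 0 δ ∧ ‖p.2.1‖ ≤ R))
    (f : Fin n → 𝓢(EuclideanSpace ℝ (Fin 4), ℝ)) :
    hatExpect r M δ R corr p S n σ f =
      corr (Real.sqrt (2 * p.2.2.1), (2 : ℝ) • p.2.2.2) (M * S) n (fun i => blockDilate M (f i)) := by
  unfold hatExpect; rw [if_neg h, if_neg hp]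

end Expect

end RealisationBridge

open RealisationBridge in
/-- **Stub 3 — chart observables ⇒ the structure's realisation block** (`RealisationFromChartObservables`, TRUE as
typed). [folklore] -/
theorem realisationFromChartObservables :
    ∀ (G : Type) [Group G] [TopologicalSpace G] [IsTopologicalGroup G] [CompactSpace G]
      [MeasurableSpace G] [BorelSpace G] (r : LatticeRep G) (M : ℕ)
      (E : Type) [NormedAddCommGroup E] [NormedSpace ℝ E] [CompleteSpace E]
      (φ : ℝ → E → ℝ) (Ψ : ℝ → E → E) (A : E →L[ℝ] E) (b₀ θ C δ R θ' : ℝ),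
      2 ≤ M → 0 < b₀ → 0 ≤ θ → θ < 1 → ‖A‖ ≤ θ → 0 < C → 0 < δ → δ ≤ R → 0 ≤ θ' → θ' < 1 →
      ParabolicBlock E φ Ψ A (b₀ * Real.log M) C δ →
      BasinBlock E φ Ψ (b₀ * Real.log M) C δ R θ' →
      ∀ (yW : ℝ → E) (g₀ : ℝ) (betaOf : ℝ → ℝ) (κ K : ℝ)
        (corr : ℝ × E → ℕ → (n : ℕ) → (Fin n → 𝓢(EuclideanSpace ℝ (Fin 4), ℝ)) → ℝ),
        ChartRealisationData G r M E φ Ψ δ R yW g₀ betaOf κ K corr →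
        Nonempty (BalabanBanachStep G r M) := by
  intro G _ _ _ _ _ _ r M E _ _ _ φ Ψ A b₀ θ C δ R θ' hM hb₀ _hθ0 hθ1 hA _hC hδ hδR hθ'0 hθ'1 hPB hBB
    yW g₀ betaOf κ K corr hCR
  have hPB' := hat_parabolicBlock hPB _hC.le
  have hBB' := hat_basinBlock hBB _hC.le hθ'0
  have hR0 : 0 ≤ R := hδ.le.trans hδR
  have hlogM : 0 < Real.log M := Real.log_pos (by exact_mod_cast (lt_of_lt_of_le one_lt_two hM))
  exact ⟨{
    E := E × (ℝ × E)
    φ := fun g x => φ g x.1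
    Ψ := hatΨ Ψ
    A := hatA A
    b := b₀ * Real.log M
    θ := max θ (1 / 2)
    C := max C (1 / 2)
    δ := δ
    b_pos := mul_pos hb₀ hlogM
    θ_nonneg := le_max_of_le_right (by norm_num)
    θ_lt_one := max_lt hθ1 (by norm_num)
    C_pos := lt_max_of_lt_right (by norm_num)
    δ_pos := hδ
    norm_A_le := norm_hatA_le A hA
    remainder := hPB'.1
    lipschitz_fibre := hPB'.2.1
    lipschitz_base := hPB'.2.2
    b₀ := b₀
    b_eq := rfl
    R := R
    δ_le_R := hδR
    θ' := max θ' (1 / 2)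
    θ'_nonneg := le_max_of_le_right (by norm_num)
    θ'_lt_one := max_lt hθ'1 (by norm_num)
    contraction := hBB'.1
    remainder_basin := hBB'.2
    yW := fun g => (yW g, ((0 : ℝ), (0 : E)))
    g₀ := g₀
    g₀_pos := hCR.g₀_pos
    continuousOn_yW := hCR.continuousOn_yW.prodMk continuousOn_const
    norm_yW_le := fun g hg => norm_triple_le (hCR.norm_yW_le g hg) (by simpa using hR0) (by simpa using hR0)
    betaOf := betaOf
    strictAntiOn_betaOf := hCR.strictAntiOn_betaOf
    continuousOn_betaOf := hCR.continuousOn_betaOf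
    κ := κ
    κ_pos := hCR.κ_pos
    K := K
    betaOf_sub_le := hCR.betaOf_sub_le
    c := fun _ => Negative.cInd r
    c_curvature := fun _ => Negative.cInd_curvature r
    expect := hatExpect r M δ R corr
    expect_step := by
      intro g x hg hx S n σ f
      have hy : ‖x.1‖ ≤ R := (norm_fst_le x).trans hx
      by_cases hσ : ∃ i, σ i ≠ r.curvature
      · rw [hatExpect_of_mixed hσ, hatExpect_of_mixed hσ]
      · rw [hatExpect_of_mem (p := (g, x)) hσ ⟨hg, hy⟩]
        by_cases hin : φ g x.1 ∈ Set.Icc 0 δ ∧ ‖Ψ g x.1‖ ≤ R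
        · rw [hatExpect_of_mem (p := (φ g x.1, hatΨ Ψ g x)) hσ (by simpa using hin)]
          exact hCR.corr_step g x.1 hg hy hin.1 hin.2 S n f
        · rw [hatExpect_of_not_mem (p := (φ g x.1, hatΨ Ψ g x)) hσ (by simpa using hin)]
          simp only [hatΨ_apply, smul_smul]
          have h2 : (2 : ℝ) * (1 / 2 * g ^ 2) = g ^ 2 := by ring
          rw [h2, Real.sqrt_sq hg.1]
          norm_num
    expect_wilson := by
      intro g hg L n σ f
      by_cases hσ : ∃ i, σ i ≠ r.curvature
      · rw [hatExpect_of_mixed hσ]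
        exact (Negative.wilsonCentredSchwinger_cInd_of_exists r (betaOf g) L n hσ f).symm
      · have hmem : g ∈ Set.Icc 0 δ ∧ ‖yW g‖ ≤ R :=
          ⟨⟨hg.1.le, hg.2.trans hCR.g₀_le_δ⟩, hCR.norm_yW_le g ⟨hg.1.le, hg.2⟩⟩
        rw [hatExpect_of_mem (p := (g, (yW g, ((0 : ℝ), (0 : E))))) hσ (by simpa using hmem)]
        push Not at hσ
        obtain rfl : σ = fun _ => r.curvature := funext hσ
        rw [hCR.corr_wilson g hg L n f]
        exact Negative.wilsonCentredSchwinger_congr_c r.ρ (betaOf g) L (fun i => by simp) f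
    continuousOn_expect := by
      intro S n σ f hf
      by_cases hσ : ∃ i, σ i ≠ r.curvature
      · exact continuousOn_const.congr fun p _ => hatExpect_of_mixed hσ f
      · have hmaps : Set.MapsTo (fun q : ℝ × (E × (ℝ × E)) => (q.1, q.2.1))
            (Set.Icc 0 δ ×ˢ Metric.closedBall 0 R) (Set.Icc 0 δ ×ˢ Metric.closedBall 0 R) := by
          intro q hq
          refine Set.mk_mem_prod hq.1 ?_
          have h2 : ‖q.2‖ ≤ R := mem_closedBall_zero_iff.mp hq.2
          exact mem_closedBall_zero_iff.mpr ((norm_fst_le q.2).trans h2)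
        have hcont : ContinuousOn ((fun p : ℝ × E => corr p S n f) ∘
            fun q : ℝ × (E × (ℝ × E)) => (q.1, q.2.1)) (Set.Icc 0 δ ×ˢ Metric.closedBall 0 R) :=
          (hCR.corr_continuousOn S n f hf).comp (by fun_prop) hmaps
        refine hcont.congr fun q hq => ?_
        have h2 : ‖q.2‖ ≤ R := mem_closedBall_zero_iff.mp hq.2
        exact hatExpect_of_mem hσ ⟨hq.1, (norm_fst_le q.2).trans h2⟩ f }⟩

end Summit.QuantumFields.YangMills.Theorems.BalabanStepParabolic

end


/-! ## The reduction: the crux from the load-bearing stub alone (kernel-checked, sorry-free) -/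

noncomputable section

namespace Summit.QuantumFields.YangMills.Theorems.BalabanStepParabolic

open Literature.MathematicalPhysics.QuantumFieldTheory

/-- **`BalabanStepParabolic` ⇐ `RegulatorChartExists`.** With the two periphery stubs of the line
`perfect-action-regulator-chart` proved above (`parabolicBlockOfSmooth`, `realisationFromChartObservables`), the
crux follows from the load-bearing stub `stub_regulatorChart` ALONE — this is the skeleton's
`BalabanStepParabolic_proof` with the two `sorry`s discharged. (Refuter drefute certificate: the line's periphery is
TRUE as typed; all remaining content sits in `∀ G r, ∃ M₀, ∀ M ≥ M₀, Nonempty (RegulatorChart G r M)`.) [folklore] -/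
theorem balabanStepParabolic_of_regulatorChartExists
    (hChart : ∀ (G : Type) [Group G] [TopologicalSpace G] [IsTopologicalGroup G] [CompactSpace G],
      IsCompactSimpleLieGroup G →
      letI : MeasurableSpace G := borel G
      haveI : BorelSpace G := ⟨rfl⟩
      ∀ (r : LatticeRep G), ∃ M₀ : ℕ, ∀ M : ℕ, M₀ ≤ M → Nonempty (RegulatorChart G r M)) :
    Summit.QuantumFields.YangMills.Theses.ParabolicTrajectory.BalabanStepParabolic := by
  intro G _ _ _ _ hG
  letI : MeasurableSpace G := borel G
  haveI : BorelSpace G := ⟨rfl⟩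
  intro r
  obtain ⟨M₀, hM₀⟩ := hChart G hG r
  refine ⟨M₀, fun M hM => ?_⟩
  obtain ⟨𝒞⟩ := hM₀ M hM
  have hs := 𝒞.smooth
  obtain ⟨φ', Ψ', C', hC', hagree, hPB, hBB⟩ :=
    parabolicBlockOfSmooth 𝒞.E 𝒞.φ 𝒞.Ψ 𝒞.A 𝒞.φg 𝒞.φy 𝒞.Ψg 𝒞.Ψy (𝒞.b₀ * Real.log M) 𝒞.C 𝒞.δ 𝒞.R 𝒞.θ' hs
  exact realisationFromChartObservables G r M 𝒞.E φ' Ψ' 𝒞.A 𝒞.b₀ 𝒞.θ C' 𝒞.δ 𝒞.R 𝒞.θ' 𝒞.two_le_M 𝒞.b₀_pos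
    𝒞.θ_nonneg 𝒞.θ_lt_one 𝒞.norm_A_le hC' hs.δ_pos hs.δ_le_R hs.θ'_nonneg 𝒞.θ'_lt_one hPB hBB 𝒞.yW 𝒞.g₀
    𝒞.betaOf 𝒞.κ 𝒞.K 𝒞.corr (𝒞.realisation.congr hagree)

/-- **Registered stub `regulatorChart_bridge`** (lead sub-goal, 2026-08-16T00:28Z): per `(G, r, M)`, an inhabited
`RegulatorChart G r M` inhabits `BalabanBanachStep G r M` — the composition of the two periphery bridges, for ANY
measurable structure making `G` Borel. TRUE as typed (refuter drefute certificate). [folklore] -/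
theorem regulatorChart_bridge_certificate :
    ∀ (G : Type) [Group G] [TopologicalSpace G] [IsTopologicalGroup G] [CompactSpace G]
      [MeasurableSpace G] [BorelSpace G] (r : LatticeRep G) (M : ℕ),
      Nonempty (RegulatorChart G r M) → Nonempty (BalabanBanachStep G r M) := by
  intro G _ _ _ _ _ _ r M h𝒞
  obtain ⟨𝒞⟩ := h𝒞
  have hs := 𝒞.smooth
  obtain ⟨φ', Ψ', C', hC', hagree, hPB, hBB⟩ :=
    parabolicBlockOfSmooth 𝒞.E 𝒞.φ 𝒞.Ψ 𝒞.A 𝒞.φg 𝒞.φy 𝒞.Ψg 𝒞.Ψy (𝒞.b₀ * Real.log M) 𝒞.C 𝒞.δ 𝒞.R 𝒞.θ' hs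
  exact realisationFromChartObservables G r M 𝒞.E φ' Ψ' 𝒞.A 𝒞.b₀ 𝒞.θ C' 𝒞.δ 𝒞.R 𝒞.θ' 𝒞.two_le_M 𝒞.b₀_pos
    𝒞.θ_nonneg 𝒞.θ_lt_one 𝒞.norm_A_le hC' hs.δ_pos hs.δ_le_R hs.θ'_nonneg 𝒞.θ'_lt_one hPB hBB 𝒞.yW 𝒞.g₀
    𝒞.betaOf 𝒞.κ 𝒞.K 𝒞.corr (𝒞.realisation.congr hagree)

end Summit.QuantumFields.YangMills.Theorems.BalabanStepParabolic


end
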